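import Literature.Probability.RandomPlanarGeometry.SAWTurnDensityWindow
import Literature.Probability.RandomPlanarGeometry.SAWPatternFiniteMemory18TurnLo
import Literature.Probability.RandomPlanarGeometry.SAWPatternFiniteMemory18TurnHi
import Literature.Probability.RandomPlanarGeometry.SAWPatternFiniteMemory18UTurnLo
import Literature.Probability.RandomPlanarGeometry.SAWPatternFiniteMemory18UTurnHi
import Literature.Probability.RandomPlanarGeometry.SAWLowerBound2604
import Literature.Probability.RandomPlanarGeometry.SAWBridges
import HarnessLib

/-!
# Explicit two-sided typical-frequency windows for turns and tight U-turns of SAWs on `ℤ²`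

Topic `Literature/Probability/RandomPlanarGeometry` (continues `SAWTurnDensityWindow.lean`).
Kesten's pattern theorem [MadrasSlade1993, Theorem 7.2.3] gives, for every proper pattern, SOME
`a > 0` such that all but exponentially few `N`-step self-avoiding walks contain the pattern at
least `aN` times; the tree's explicit instance for the tight U-turn is `Zd.hairpin_density_explicit`
(`a = 1/1280`). Here four memory-18 pattern-tilted Pönitz–Tittmann certificates
(`checkPC 18 …`, `336 168` normal forms each, `native_decide` lineage) bound the turn- and
U-turn-weighted partition functions at tilts `t = 3/5, 9/5` (turns) and `t = 3/10, 11/5` (U-turns):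
`Z_N(3/5) ≤ 2⁴¹·2.03^N`, `Z_N(9/5) ≤ 2⁴¹·3.9898^N`, `Σ_{S_N}(3/10)^{#U} ≤ 2⁴¹·2.4719^N`,
`Σ_{S_N}(11/5)^{#U} ≤ 2⁴¹·3.0108^N`, and the Chernoff transfer of `SAWTurnDensityWindow.lean`
turns them into EXPLICIT TWO-SIDED WINDOWS:

* with the tree's kernel certificate `μ(ℤ²) ≥ 2.604` (`le_connectiveConstant_2604`):
  **`turnWindow_Z2 : TurnWindow (12/25) (73/100)`** — all but exponentially few `N`-step SAWs on
  `ℤ²` turn at between `48 %` and `73 %` of their `N - 1` internal vertices — and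
  **`uturnWindow_Z2 : UTurnWindow (1/24) (3/16)`** — they contain between `N/24` and `3N/16`
  tight U-turns (trivial sup-density `1/2`; exact enumeration suggests `≈ 0.61` and `≈ 0.10`);
* with the printed bound `μ(ℤ²) ≥ 2.625622` (Jensen 2004) as a hypothesis:
  **`turnWindow_Z2_of_printed : TurnWindow (1/2) (18/25)`** (more than half of the internal
  vertices are turns) and **`uturnWindow_Z2_of_printed : UTurnWindow (1/20) (7/40)`**;
* the edges for ANY certified `μlo ≤ μ` with the rates in closed form (`turnsLower_of_le`, …);
* the transfer to BRIDGES (`Zd.TurnWindowB`, a-idea-2's shape; `turnWindowB_of_turnWindow`,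
  `TurnWindowB.mono`, `windowTransfer`, `turnWindowB_Z2`): bridges are self-avoiding walks and an
  exponential bound `C θ^N μ^N` passes to subsets — in general every edge passes to any
  sub-ensemble `S ⊆ S_N` (`TurnsLower.card_filter_le`, …: closing walks = rooted polygons,
  half-space walks, …).

Each window fraction `m/n` is certified by the exact rational test `Λ^n < t^m · μlo^n`
(`Zd.theta_lt_one`), e.g. `2.03² = 4.1209 < 0.6 · 2.625622² = 4.1363…` for `a = 1/2`.
The exceptional sets decay like `θ^N` with `θ ∈ (0.985, 0.9982)` (docstrings). Non-standard axiom: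
`Lean.ofReduceBool` through the four certificates (and through `le_connectiveConstant_2604` for the
kernel-`μ` editions).

## References

* N. Madras, G. Slade, *The Self-Avoiding Walk* (1993), Theorem 7.2.3 (Kesten's pattern theorem;
  inexplicit `a`), §7.1 [MadrasSlade1993].
* A. Pönitz, P. Tittmann, *Improved upper bounds for self-avoiding walks in ℤᵈ*, Electron. J.
  Combin. 7 (2000) R21, §3 [PonitzTittmann2000].
* I. Jensen, *Improved lower bounds on the connective constants for two-dimensional self-avoiding
  walks*, J. Phys. A 37 (2004) 11521–11529, §2 eq. (4) (`μ(ℤ²) ≥ 2.625622`) [Jensen2004SAWLowerBounds].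
-/

noncomputable section

open Finset Literature.Probability.LatticeModels
open scoped BigOperators

namespace Literature.Probability.RandomPlanarGeometry.SAW

namespace Zd

/-! ### The four certified pressures (memory 18, normal forms, `native_decide` lineage) -/

/-- **Certified bending pressure at `t = 3/5`**: `Σ_{ω ∈ S_N} (3/5)^{turns ω} ≤ 2⁴¹ · 2.03^N`
(`checkPC 18 0 3 5 10150 1000 80`). [cite: PonitzTittmann2000, §3] -/
theorem zbendUpper_three_fifths : ZbendUpper (3 / 5) (203 / 100) (2 ^ 41) := by
  have h := FiniteMemory.zbendUpper_of_checkPC FiniteMemory.checkPC_18_turn_3_5 (by norm_num) (by norm_num)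
  norm_num at h
  rw [show (2 : ℝ) ^ 41 = 2199023255552 by norm_num]
  exact h

/-- **Certified bending pressure at `t = 9/5`**: `Σ_{ω ∈ S_N} (9/5)^{turns ω} ≤ 2⁴¹ · 3.9898^N`
(`checkPC 18 0 9 5 19949 1000 80`). [cite: PonitzTittmann2000, §3] -/
theorem zbendUpper_nine_fifths : ZbendUpper (9 / 5) (19949 / 5000) (2 ^ 41) := by
  have h := FiniteMemory.zbendUpper_of_checkPC FiniteMemory.checkPC_18_turn_9_5 (by norm_num) (by norm_num)
  norm_num at h
  rw [show (2 : ℝ) ^ 41 = 2199023255552 by norm_num]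
  exact h

/-- **Certified U-turn pressure at `t = 3/10`**: `Σ_{ω ∈ S_N} (3/10)^{uturns ω} ≤ 2⁴¹ · 2.4719^N`
(`checkPC 18 1 3 10 24719 1000 80`). [cite: PonitzTittmann2000, §3] -/
theorem zubendUpper_three_tenths : ZUbendUpper (3 / 10) (24719 / 10000) (2 ^ 41) := by
  have h := FiniteMemory.zubendUpper_of_checkPC FiniteMemory.checkPC_18_uturn_3_10 (by norm_num) (by norm_num)
  norm_num at h
  rw [show (2 : ℝ) ^ 41 = 2199023255552 by norm_num]
  exact h

/-- **Certified U-turn pressure at `t = 11/5`**: `Σ_{ω ∈ S_N} (11/5)^{uturns ω} ≤ 2⁴¹ · 3.0108^N`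
(`checkPC 18 1 11 5 15054 1000 80`). [cite: PonitzTittmann2000, §3] -/
theorem zubendUpper_eleven_fifths : ZUbendUpper (11 / 5) (7527 / 2500) (2 ^ 41) := by
  have h := FiniteMemory.zubendUpper_of_checkPC FiniteMemory.checkPC_18_uturn_11_5 (by norm_num) (by norm_num)
  norm_num at h
  rw [show (2 : ℝ) ^ 41 = 2199023255552 by norm_num]
  exact h

/-! ### The four edges for an arbitrary certified lower bound `μlo ≤ μ(ℤ²)` -/

/-- LOWER turn edge, any `μlo`: `#{ω ∈ S_N : turns ≤ a(N-1)} ≤ 2⁴¹(3/5)^a · (2.03/((3/5)^a μlo))^N · μ^N`.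
[cite: MadrasSlade1993, Theorem 7.2.3 (shape); PonitzTittmann2000, §3] -/
theorem turnsLower_of_le {μlo : ℝ} (hμ0 : 0 < μlo) (hμ : μlo ≤ connectiveConstant 2) (a : ℝ) :
    TurnsLower a ((203 / 100) / ((3 / 5 : ℝ) ^ a * μlo)) (2 ^ 41 * (3 / 5 : ℝ) ^ a) :=
  chernoffLower _ _ _ a μlo (by norm_num) (by norm_num) (by norm_num) hμ0 hμ zbendUpper_three_fifths

/-- UPPER turn edge, any `μlo`: `#{ω ∈ S_N : b(N-1) ≤ turns} ≤ 2⁴¹(9/5)^b · (3.9898/((9/5)^b μlo))^N · μ^N`.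
[cite: MadrasSlade1993, Theorem 7.2.3 (shape); PonitzTittmann2000, §3] -/
theorem turnsUpper_of_le {μlo : ℝ} (hμ0 : 0 < μlo) (hμ : μlo ≤ connectiveConstant 2) (b : ℝ) :
    TurnsUpper b ((19949 / 5000) / ((9 / 5 : ℝ) ^ b * μlo)) (2 ^ 41 * (9 / 5 : ℝ) ^ b) :=
  chernoffUpper _ _ _ b μlo (by norm_num) (by norm_num) hμ0 hμ zbendUpper_nine_fifths

/-- LOWER U-turn edge, any `μlo`: `#{ω ∈ S_N : uturns ≤ aN} ≤ 2⁴¹ · (2.4719/((3/10)^a μlo))^N · μ^N`.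
[cite: MadrasSlade1993, Theorem 7.2.3 (shape); PonitzTittmann2000, §3] -/
theorem uturnsLower_of_le {μlo : ℝ} (hμ0 : 0 < μlo) (hμ : μlo ≤ connectiveConstant 2) (a : ℝ) :
    UTurnsLower a ((24719 / 10000) / ((3 / 10 : ℝ) ^ a * μlo)) (2 ^ 41) :=
  chernoffLowerU _ _ _ a μlo (by norm_num) (by norm_num) (by norm_num) hμ0 hμ zubendUpper_three_tenths

/-- UPPER U-turn edge, any `μlo`: `#{ω ∈ S_N : bN ≤ uturns} ≤ 2⁴¹ · (3.0108/((11/5)^b μlo))^N · μ^N`.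
[cite: MadrasSlade1993, Theorem 7.2.3 (shape); PonitzTittmann2000, §3] -/
theorem uturnsUpper_of_le {μlo : ℝ} (hμ0 : 0 < μlo) (hμ : μlo ≤ connectiveConstant 2) (b : ℝ) :
    UTurnsUpper b ((7527 / 2500) / ((11 / 5 : ℝ) ^ b * μlo)) (2 ^ 41) :=
  chernoffUpperU _ _ _ b μlo (by norm_num) (by norm_num) hμ0 hμ zubendUpper_eleven_fifths

/-! ### The windows with the tree's certificate `μ(ℤ²) ≥ 2.604` -/

/-- `2.604 ≤ μ(ℤ²)` in the `Zd` vocabulary. [cite: Jensen2004SAWLowerBounds, §2, eq. (4)] -/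
private theorem mu_ge : (2.604 : ℝ) ≤ connectiveConstant 2 := by
  rw [Zd.connectiveConstant_two]; exact le_connectiveConstant_2604

/-- **Turn window with the kernel certificate `μ ≥ 2.604`: all but exponentially few `N`-step
self-avoiding walks on `ℤ²` turn at between `48 %` and `73 %` of their `N - 1` internal vertices**
(`TurnWindow (12/25) (73/100)`; rates `θ = 2.03/(0.6^{0.48}·2.604) ≈ 0.9962` and
`3.9898/(1.8^{0.73}·2.604) ≈ 0.9977`, constant `2⁴¹·1.8^{0.73}`).
[cite: MadrasSlade1993, Theorem 7.2.3 (explicit two-sided instance for turns on ℤ²); PonitzTittmann2000, §3] -/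
theorem turnWindow_Z2 : TurnWindow (12 / 25) (73 / 100) := by
  have h₁ := turnsLower_of_le (by norm_num : (0 : ℝ) < 2.604) mu_ge ((12 : ℕ) / (25 : ℕ) : ℝ)
  have h₂ := turnsUpper_of_le (by norm_num : (0 : ℝ) < 2.604) mu_ge ((73 : ℕ) / (100 : ℕ) : ℝ)
  have e₁ : ((12 : ℕ) / (25 : ℕ) : ℝ) = 12 / 25 := by norm_num
  have e₂ : ((73 : ℕ) / (100 : ℕ) : ℝ) = 73 / 100 := by norm_num
  have hθ₁ := theta_lt_one (Λ := 203 / 100) (t := 3 / 5) (μlo := 2.604) (m := 12) (n := 25)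
    (by norm_num) (by norm_num) (by norm_num) (by norm_num)
  have hθ₂ := theta_lt_one (Λ := 19949 / 5000) (t := 9 / 5) (μlo := 2.604) (m := 73) (n := 100)
    (by norm_num) (by norm_num) (by norm_num) (by norm_num)
  rw [e₁] at h₁ hθ₁; rw [e₂] at h₂ hθ₂
  exact turnWindow_of_edges h₁ h₂ (by positivity) hθ₁ (by positivity) hθ₂ (by positivity) (by positivity)

/-- **U-turn window with the kernel certificate `μ ≥ 2.604`: all but exponentially few `N`-step
self-avoiding walks on `ℤ²` contain between `N/24` and `3N/16` tight U-turns**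
(`UTurnWindow (1/24) (3/16)`; the tree's `Zd.hairpin_density_explicit` has `N/1280`, the trivial
sup-density is `1/2`). [cite: MadrasSlade1993, Theorem 7.2.3 (explicit two-sided instance for the U-turn on ℤ²); PonitzTittmann2000, §3] -/
theorem uturnWindow_Z2 : UTurnWindow (1 / 24) (3 / 16) := by
  have h₁ := uturnsLower_of_le (by norm_num : (0 : ℝ) < 2.604) mu_ge ((1 : ℕ) / (24 : ℕ) : ℝ)
  have h₂ := uturnsUpper_of_le (by norm_num : (0 : ℝ) < 2.604) mu_ge ((3 : ℕ) / (16 : ℕ) : ℝ)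
  have e₁ : ((1 : ℕ) / (24 : ℕ) : ℝ) = 1 / 24 := by norm_num
  have e₂ : ((3 : ℕ) / (16 : ℕ) : ℝ) = 3 / 16 := by norm_num
  have hθ₁ := theta_lt_one (Λ := 24719 / 10000) (t := 3 / 10) (μlo := 2.604) (m := 1) (n := 24)
    (by norm_num) (by norm_num) (by norm_num) (by norm_num)
  have hθ₂ := theta_lt_one (Λ := 7527 / 2500) (t := 11 / 5) (μlo := 2.604) (m := 3) (n := 16)
    (by norm_num) (by norm_num) (by norm_num) (by norm_num)
  rw [e₁] at h₁ hθ₁; rw [e₂] at h₂ hθ₂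
  exact uturnWindow_of_edges h₁ h₂ (by positivity) hθ₁ (by positivity) hθ₂ (by positivity) (by positivity)

/-! ### The windows under the printed bound `μ(ℤ²) ≥ 2.625622` (Jensen 2004), as a hypothesis -/

/-- **Turn window under the printed `μ ≥ 2.625622`: more than HALF of the internal vertices of all
but exponentially few self-avoiding walks on `ℤ²` are turns, and at most `72 %`**
(`TurnWindow (1/2) (18/25)`; the test at `a = 1/2` is `2.03² < 0.6 · 2.625622²`).
[cite: MadrasSlade1993, Theorem 7.2.3 (explicit two-sided instance); Jensen2004SAWLowerBounds, §2, eq. (4)] -/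
theorem turnWindow_Z2_of_printed (hμ : (2.625622 : ℝ) ≤ connectiveConstant 2) :
    TurnWindow (1 / 2) (18 / 25) := by
  have h₁ := turnsLower_of_le (by norm_num : (0 : ℝ) < 2.625622) hμ ((1 : ℕ) / (2 : ℕ) : ℝ)
  have h₂ := turnsUpper_of_le (by norm_num : (0 : ℝ) < 2.625622) hμ ((18 : ℕ) / (25 : ℕ) : ℝ)
  have e₁ : ((1 : ℕ) / (2 : ℕ) : ℝ) = 1 / 2 := by norm_num
  have e₂ : ((18 : ℕ) / (25 : ℕ) : ℝ) = 18 / 25 := by norm_num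
  have hθ₁ := theta_lt_one (Λ := 203 / 100) (t := 3 / 5) (μlo := 2.625622) (m := 1) (n := 2)
    (by norm_num) (by norm_num) (by norm_num) (by norm_num)
  have hθ₂ := theta_lt_one (Λ := 19949 / 5000) (t := 9 / 5) (μlo := 2.625622) (m := 18) (n := 25)
    (by norm_num) (by norm_num) (by norm_num) (by norm_num)
  rw [e₁] at h₁ hθ₁; rw [e₂] at h₂ hθ₂
  exact turnWindow_of_edges h₁ h₂ (by positivity) hθ₁ (by positivity) hθ₂ (by positivity) (by positivity)

/-- **U-turn window under the printed `μ ≥ 2.625622`: between `N/20` and `7N/40` tight U-turns in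
all but exponentially few `N`-step self-avoiding walks on `ℤ²`** (`UTurnWindow (1/20) (7/40)`).
[cite: MadrasSlade1993, Theorem 7.2.3 (explicit two-sided instance); Jensen2004SAWLowerBounds, §2, eq. (4)] -/
theorem uturnWindow_Z2_of_printed (hμ : (2.625622 : ℝ) ≤ connectiveConstant 2) :
    UTurnWindow (1 / 20) (7 / 40) := by
  have h₁ := uturnsLower_of_le (by norm_num : (0 : ℝ) < 2.625622) hμ ((1 : ℕ) / (20 : ℕ) : ℝ)
  have h₂ := uturnsUpper_of_le (by norm_num : (0 : ℝ) < 2.625622) hμ ((7 : ℕ) / (40 : ℕ) : ℝ)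
  have e₁ : ((1 : ℕ) / (20 : ℕ) : ℝ) = 1 / 20 := by norm_num
  have e₂ : ((7 : ℕ) / (40 : ℕ) : ℝ) = 7 / 40 := by norm_num
  have hθ₁ := theta_lt_one (Λ := 24719 / 10000) (t := 3 / 10) (μlo := 2.625622) (m := 1) (n := 20)
    (by norm_num) (by norm_num) (by norm_num) (by norm_num)
  have hθ₂ := theta_lt_one (Λ := 7527 / 2500) (t := 11 / 5) (μlo := 2.625622) (m := 7) (n := 40)
    (by norm_num) (by norm_num) (by norm_num) (by norm_num)
  rw [e₁] at h₁ hθ₁; rw [e₂] at h₂ hθ₂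
  exact uturnWindow_of_edges h₁ h₂ (by positivity) hθ₁ (by positivity) hθ₂ (by positivity) (by positivity)

end Zd

end Literature.Probability.RandomPlanarGeometry.SAW

namespace Literature.Probability.RandomPlanarGeometry.SAW.Zd

/-! ### Transfer to bridges (a-idea-2's `TurnWindowB` / `WindowTransfer`): bridges are walks -/

/-- The two-sided turn window over BRIDGES (`Zd.bridges 2 N`), in the shape of a-idea-2's
`TurnWindowB` (verbatim body): the bridges with turn frequency outside `[a, b]` number at most
`C θ^N μ^N`. [cite: MadrasSlade1993, Theorem 7.2.3 (shape)] -/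
def TurnWindowB (a b : ℝ) : Prop :=
  ∃ θ C : ℝ, θ < 1 ∧ ∀ N : ℕ,
    (((Zd.bridges 2 N).filter fun ω =>
        (turns N ω : ℝ) ≤ a * ((N : ℝ) - 1) ∨ b * ((N : ℝ) - 1) ≤ (turns N ω : ℝ)).card : ℝ)
      ≤ C * θ ^ N * connectiveConstant 2 ^ N

/-- **A turn window for walks is a turn window for bridges** (bridges are self-avoiding walks, and
an exponential bound `C θ^N μ^N` is insensitive to passing to a subset; constant `2C`).
[cite: MadrasSlade1993, Theorem 7.2.3 (shape); §1.2] -/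
theorem turnWindowB_of_turnWindow {a b : ℝ} (h : TurnWindow a b) : TurnWindowB a b := by
  classical
  obtain ⟨θ, C, hθ, hlo, hup⟩ := h
  refine ⟨θ, 2 * C, hθ, fun N => ?_⟩
  have h1 := hlo N
  have h2 := hup N
  have hsub : ((Zd.bridges 2 N).filter fun ω =>
      (turns N ω : ℝ) ≤ a * ((N : ℝ) - 1) ∨ b * ((N : ℝ) - 1) ≤ (turns N ω : ℝ)) ⊆
      ((Zd.saws 2 N).filter fun ω => (turns N ω : ℝ) ≤ a * ((N : ℝ) - 1)) ∪
        ((Zd.saws 2 N).filter fun ω => b * ((N : ℝ) - 1) ≤ (turns N ω : ℝ)) := by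
    intro ω hω
    rw [Finset.mem_filter, Zd.mem_bridges] at hω
    rw [Finset.mem_union, Finset.mem_filter, Finset.mem_filter]
    rcases hω.2 with h | h
    · exact Or.inl ⟨hω.1.1, h⟩
    · exact Or.inr ⟨hω.1.1, h⟩
  have hcard := (Finset.card_le_card hsub).trans (Finset.card_union_le _ _)
  have hcast : (((Zd.bridges 2 N).filter fun ω =>
      (turns N ω : ℝ) ≤ a * ((N : ℝ) - 1) ∨ b * ((N : ℝ) - 1) ≤ (turns N ω : ℝ)).card : ℝ) ≤
      (((Zd.saws 2 N).filter fun ω => (turns N ω : ℝ) ≤ a * ((N : ℝ) - 1)).card : ℝ) +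
        (((Zd.saws 2 N).filter fun ω => b * ((N : ℝ) - 1) ≤ (turns N ω : ℝ)).card : ℝ) := by
    exact_mod_cast hcard
  linarith

/-- Monotonicity of the bridge window in the thresholds (`a' ≤ a`, `b ≤ b'`): for `N ≥ 1` the
exceptional sets shrink; the one walk of length `0` is absorbed by the constant (`θ > 0` is forced
by the window at `N = 1`, where every bridge is exceptional). [cite: MadrasSlade1993, Theorem 7.2.3 (shape)] -/
theorem TurnWindowB.mono {a b a' b' : ℝ} (h : TurnWindowB a b) (ha : a' ≤ a) (hb : b ≤ b') :
    TurnWindowB a' b' := by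
  classical
  obtain ⟨θ, C, hθ, hN⟩ := h
  have hC : 0 ≤ C := by
    have h0 := hN 0
    simp only [pow_zero, mul_one] at h0
    exact le_trans (Nat.cast_nonneg _) h0
  -- at `N = 1` every bridge is exceptional (`turns = 0`, thresholds `0`), so `C θ μ ≥ b₁ ≥ 1`
  have hθpos : 0 < θ := by
    have h1 := hN 1
    have hall : ((Zd.bridges 2 1).filter fun ω =>
        (turns 1 ω : ℝ) ≤ a * (((1 : ℕ) : ℝ) - 1) ∨ b * (((1 : ℕ) : ℝ) - 1) ≤ (turns 1 ω : ℝ)) =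
        Zd.bridges 2 1 := by
      refine Finset.filter_true_of_mem fun ω _ => Or.inr ?_
      simp
    rw [hall] at h1
    have hb1 : (1 : ℝ) ≤ ((Zd.bridges 2 1).card : ℝ) := by
      exact_mod_cast Zd.one_le_bridgeCount (d := 2) 1
    have hμ : 0 < connectiveConstant 2 ^ 1 := pow_pos (connectiveConstant_pos 2) 1
    by_contra hle
    rw [not_lt] at hle
    have : C * θ ^ 1 * connectiveConstant 2 ^ 1 ≤ 0 :=
      mul_nonpos_of_nonpos_of_nonneg (mul_nonpos_of_nonneg_of_nonpos hC (by rw [pow_one]; exact hle)) hμ.le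
    linarith
  refine ⟨θ, C + 1, hθ, fun N => ?_⟩
  have hμN : 0 ≤ connectiveConstant 2 ^ N := pow_nonneg (connectiveConstant_pos 2).le N
  have hθN : 0 ≤ θ ^ N := pow_nonneg hθpos.le N
  rcases Nat.eq_zero_or_pos N with rfl | hpos
  · -- N = 0: at most one walk
    have hcard : (((Zd.bridges 2 0).filter fun ω =>
        (turns 0 ω : ℝ) ≤ a' * (((0 : ℕ) : ℝ) - 1) ∨ b' * (((0 : ℕ) : ℝ) - 1) ≤ (turns 0 ω : ℝ)).card : ℝ)
        ≤ 1 := by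
      have : ((Zd.bridges 2 0).filter fun ω =>
          (turns 0 ω : ℝ) ≤ a' * (((0 : ℕ) : ℝ) - 1) ∨ b' * (((0 : ℕ) : ℝ) - 1) ≤ (turns 0 ω : ℝ)).card ≤
          (Zd.saws 2 0).card :=
        Finset.card_le_card fun ω hω => (Zd.mem_bridges.1 (Finset.mem_filter.1 hω).1).1
      rw [Zd.card_saws, Zd.count_zero] at this
      exact_mod_cast this
    simp only [pow_zero, mul_one]
    linarith
  · have hN1 : (0 : ℝ) ≤ (N : ℝ) - 1 := by
      have : (1 : ℝ) ≤ N := by exact_mod_cast hpos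
      linarith
    have hsub : ((Zd.bridges 2 N).filter fun ω =>
        (turns N ω : ℝ) ≤ a' * ((N : ℝ) - 1) ∨ b' * ((N : ℝ) - 1) ≤ (turns N ω : ℝ)) ⊆
        ((Zd.bridges 2 N).filter fun ω =>
          (turns N ω : ℝ) ≤ a * ((N : ℝ) - 1) ∨ b * ((N : ℝ) - 1) ≤ (turns N ω : ℝ)) := by
      intro ω hω
      rw [Finset.mem_filter] at hω ⊢
      exact ⟨hω.1, hω.2.imp (fun h => h.trans (mul_le_mul_of_nonneg_right ha hN1))
        (fun h => le_trans (mul_le_mul_of_nonneg_right hb hN1) h)⟩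
    have h1 : (((Zd.bridges 2 N).filter fun ω =>
        (turns N ω : ℝ) ≤ a' * ((N : ℝ) - 1) ∨ b' * ((N : ℝ) - 1) ≤ (turns N ω : ℝ)).card : ℝ) ≤
        C * θ ^ N * connectiveConstant 2 ^ N :=
      le_trans (by exact_mod_cast Finset.card_le_card hsub) (hN N)
    calc _ ≤ C * θ ^ N * connectiveConstant 2 ^ N := h1
      _ ≤ (C + 1) * θ ^ N * connectiveConstant 2 ^ N :=
          mul_le_mul_of_nonneg_right (mul_le_mul_of_nonneg_right (by linarith) hθN) hμN

/-- **a-idea-2's `WindowTransfer`** (verbatim conclusion): a turn window for walks with `[a, b]`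
gives a turn window for bridges with any wider `[a', b']`. [cite: MadrasSlade1993, Theorem 7.2.3 (shape)] -/
theorem windowTransfer (a b : ℝ) (h : TurnWindow a b) (a' b' : ℝ) (ha : a' < a) (hb : b < b') :
    TurnWindowB a' b' :=
  (turnWindowB_of_turnWindow h).mono ha.le hb.le

/-- **Turn window for BRIDGES on `ℤ²`** with the kernel certificate `μ ≥ 2.604`:
`TurnWindowB (12/25) (73/100)`. [cite: MadrasSlade1993, Theorem 7.2.3 (explicit instance)] -/
theorem turnWindowB_Z2 : TurnWindowB (12 / 25) (73 / 100) := turnWindowB_of_turnWindow turnWindow_Z2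

end Literature.Probability.RandomPlanarGeometry.SAW.Zd

namespace Literature.Probability.RandomPlanarGeometry.SAW.Zd

/-! ### Sub-ensembles (bridges, closing walks = rooted polygons, half-space walks, …) inherit every edge -/

/-- A lower turn edge passes to any sub-ensemble `S ⊆ S_N`. [cite: MadrasSlade1993, Theorem 7.2.3 (shape)] -/
theorem TurnsLower.card_filter_le {a θ C : ℝ} (h : TurnsLower a θ C) {N : ℕ}
    {S : Finset (ℕ → Site 2)} (hS : S ⊆ Zd.saws 2 N) :
    ((S.filter fun ω => (turns N ω : ℝ) ≤ a * ((N : ℝ) - 1)).card : ℝ) ≤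
      C * θ ^ N * connectiveConstant 2 ^ N :=
  le_trans (by exact_mod_cast Finset.card_le_card (Finset.filter_subset_filter _ hS)) (h N)

/-- An upper turn edge passes to any sub-ensemble `S ⊆ S_N`. [cite: MadrasSlade1993, Theorem 7.2.3 (shape)] -/
theorem TurnsUpper.card_filter_le {b θ C : ℝ} (h : TurnsUpper b θ C) {N : ℕ}
    {S : Finset (ℕ → Site 2)} (hS : S ⊆ Zd.saws 2 N) :
    ((S.filter fun ω => b * ((N : ℝ) - 1) ≤ (turns N ω : ℝ)).card : ℝ) ≤
      C * θ ^ N * connectiveConstant 2 ^ N :=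
  le_trans (by exact_mod_cast Finset.card_le_card (Finset.filter_subset_filter _ hS)) (h N)

/-- A lower U-turn edge passes to any sub-ensemble `S ⊆ S_N`. [cite: MadrasSlade1993, Theorem 7.2.3 (shape)] -/
theorem UTurnsLower.card_filter_le {a θ C : ℝ} (h : UTurnsLower a θ C) {N : ℕ}
    {S : Finset (ℕ → Site 2)} (hS : S ⊆ Zd.saws 2 N) :
    ((S.filter fun ω => (uturns N ω : ℝ) ≤ a * (N : ℝ)).card : ℝ) ≤
      C * θ ^ N * connectiveConstant 2 ^ N :=
  le_trans (by exact_mod_cast Finset.card_le_card (Finset.filter_subset_filter _ hS)) (h N)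

/-- An upper U-turn edge passes to any sub-ensemble `S ⊆ S_N`. [cite: MadrasSlade1993, Theorem 7.2.3 (shape)] -/
theorem UTurnsUpper.card_filter_le {b θ C : ℝ} (h : UTurnsUpper b θ C) {N : ℕ}
    {S : Finset (ℕ → Site 2)} (hS : S ⊆ Zd.saws 2 N) :
    ((S.filter fun ω => b * (N : ℝ) ≤ (uturns N ω : ℝ)).card : ℝ) ≤
      C * θ ^ N * connectiveConstant 2 ^ N :=
  le_trans (by exact_mod_cast Finset.card_le_card (Finset.filter_subset_filter _ hS)) (h N)

end Literature.Probability.RandomPlanarGeometry.SAW.Zd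

end
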